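import Summits.QuantumFields.YangMills.Theorems.LuscherReductionTwistedTraceScalingBOStiffFlatDefs
import HarnessLib

/-!
# (B-ST) central-fibre objects with a GENERAL CAP CONSTANT `K` (route-posited abbreviations for the K-port of lane A's `hST_record_low`)
# (route `FlatTubeReduction`, crux K1 `NearFlatRatioLaw` stmt-QuantumFields-24720, line `ratepack_v2`, stub `stub_hST_A`; seat `ym-line-ftr-p1` g20; R2b1 RECORD rung — no summit statement is proved here)

Lane A's (B-ST) brick of record ✓`…BOStiffHSTLow.hST_record_low` is stated for the record weight `recordChi L s 43 M β` (cap constant `43`), through the central-fibre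
abbreviations of ✓`…BOStiffDefs` / ✓`…BOStiffFlatDefs` which bake `43` in: `cW L s M β x = softWeight (recordChi L s 43 M β) (orthoTube 1 x)`, `cZ = ∫ cΘ²·cW`, `cΛ = ∫∫ cΘ·cM·cΘ / cZ`,
`cJ0 = cΘ⊗cK⊗cΘ·cZ/cIk`.  The rate twin of crux K1 (stub `stub_hST_A` of skeleton «ratepack_v2») needs the same brick at the cap constant `K = 42·max 1 (|Site 3 L|/7) + 1`
(`s = 1/6`).  THIS FILE only NAMES the four K-generic twins (no claims): `cWK L s K M`, `cZK L s K M`, `cΛK L s K M`, `cJ0K L s K M` — at `K = 43` they are lane A's objects by `rfl`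
(`cWK_fortyThree`, `cZK_fortyThree`, `cΛK_fortyThree`, `cJ0K_fortyThree`).  The K-ported theorems live in `Theorems/FlatTubeReductionStiffK*.lean`.
HONEST FRAMING: definitions for a stub of the crux K1 of the CONDITIONAL route R2b1 (RECORD rung); (B-ST) at general `K` OPEN until the port lands; not infinite volume, not a gap, not Clay.
-/

set_option autoImplicit false

noncomputable section

open MeasureTheory

namespace Summit.QuantumFields.YangMills.Theorems.FemtoTransferGap.TwoLattice.ConstTube

open Literature.MathematicalPhysics.QuantumFieldTheory Literature.MathematicalPhysics.QuantumLattice TwoLattice.Avg TwoLattice.Stiff TwoLattice.GnChart TwoLattice.Cov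

variable (L : ℕ) [NeZero L]

/-- The **central weight with cap constant `K`**: `cWK s K M β x = softWeight (recordChi L s K M β) (orthoTube 1 x)` (`= gaugeAvg χ / χ` at the central tube point).
[cite: SeilerLNP1982, §2] -/
def cWK (s K M β : ℝ) (x : Edge 3 L → Fin 3 → ℝ) : ℝ := softWeight (recordChi L s K M β) (orthoTube L 1 x)

/-- The **profile mass with cap constant `K`**: `cZK s K M β = ∫ cΘ²·cWK dπ` (the denominator of `cΛK`). [folklore] -/
def cZK (s K M β : ℝ) : ℝ := ∫ x, cΘ L β x ^ 2 * cWK L s K M β x ∂orthoTransverse L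

/-- The profile's **Rayleigh quotient with cap constant `K`**: `cΛK = ∫∫ cΘ·cM·cΘ dπ dπ / ∫ cΘ²·cWK dπ`. [cite: Luscher1983, §3] -/
def cΛK (s K M β : ℝ) : ℝ :=
  (∫ x, ∫ y, cΘ L β x * cM L β x y * cΘ L β y ∂orthoTransverse L ∂orthoTransverse L) / ∫ x, cΘ L β x ^ 2 * cWK L s K M β x ∂orthoTransverse L

/-- The **π-normalised model jump kernel with cap constant `K`**: `cJ0K s K M β x x' = cΘ(x)·cK(x,x')·cΘ(x')·cZK/cIk`. [cite: Luscher1983, §3] -/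
def cJ0K (s K M β : ℝ) (x x' : Edge 3 L → Fin 3 → ℝ) : ℝ := cΘ L β x * cK L β x x' * cΘ L β x' * (cZK L s K M β / cIk L β)

/-- At `K = 43`, `cWK` is lane A's `cW`. [folklore] -/
theorem cWK_fortyThree (s M : ℝ) : cWK L s 43 M = cW L s M := rfl

/-- At `K = 43`, `cZK` is lane A's `cZ`. [folklore] -/
theorem cZK_fortyThree (s M : ℝ) : cZK L s 43 M = cZ L s M := rfl

/-- At `K = 43`, `cΛK` is lane A's `cΛ`. [folklore] -/
theorem cΛK_fortyThree (s M : ℝ) : cΛK L s 43 M = cΛ L s M := rfl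

/-- At `K = 43`, `cJ0K` is lane A's `cJ0`. [folklore] -/
theorem cJ0K_fortyThree (s M : ℝ) : cJ0K L s 43 M = cJ0 L s M := rfl

end Summit.QuantumFields.YangMills.Theorems.FemtoTransferGap.TwoLattice.ConstTube

end
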